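import Literature.MathematicalPhysics.QuantumFieldTheory.Balaban1983to89.B3DivergentGraphs

/-!
# `Balaban1983to89.B3Sect3Graphs318` — T. Bałaban, *(Higgs)₂,₃ quantum fields in a finite volume. III. Renormalization*,
Commun. Math. Phys. **88** (1983) 411–445 [Balaban1983Higgs3]: the PICTURES (3.18) p. 438 — *"Primitively divergent graphs, i.e.
the graphs (3.18)"* (self-energy graphs for scalar fields of degree 0) — as graphs of the concrete family `B3Cor23Concrete.Graph`,
with their degrees

statement-level skeleton of published theorems with citation tags; proofs where landed; nothing here is a claim about the Yang–Mills mass gap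

PDF held: `paper:balaban1983-higgs-2-3-quantum-fields-finite-volume` (journal page = PDF page + 410); the display read as image,
with strip crops of both rows: `…/b2b-balaban-ref1/pages/1983-cmp88-higgs23-III/1983-cmp88-higgs23-III-p028-x2.png` (p. 438).
CITATION HEADER (lean-in-tree rule).  lit-balaban TYPED SKELETON (HOME `run/shared/lean/pub/lit-balaban/`), Phase 2, seat p18 (gen 3),
unit `lit-balaban-p18`; SKELETON row **B3.Eq3.18-3.20** (cell so far: «pictures (3.18)/(3.20) … not typed»), fold owner r15.  Reading
of the pictures (legend (1.17) p. 415): straight = φ′, wavy = A′, small circle = vertex (1.8)/(1.10), dot = vertex (1.6), arrowhead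
adjacent to a vertex = the differentiation D^η_B̃ of that vertex (1.8) (leg 0 of the model; cf. (3.21), where the second arrowhead
sits on an external leg).  Model and leg counts: `B3Cor23Concrete` (gen 1), `B3DivergentGraphs` (gen 2); the degree sentence of
p. 438 (*"All the remaining divergent graphs of this type have degrees equal to 0"*) is PROVED for the whole class in
`…B3Sect3ScalarSEDegrees` (via `…B3Sect3DegreeCensus`).

WHAT THIS MODULE CONTAINS (sorry-free; `def`s = graphs of the model and two vertex assignments; no `Prop` fact introduced).  The seven
pictures in printed order: `g318a` (two (1.10)_{2,0}: φ′-line + both A′-lines), `g318b` ((1.10)_{4,0} with two A′-tadpoles),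
`g318c` ((1.8)_{2,0}–(1.10)_{2,0}: φ′-line through the differentiated leg + both A′-lines), `g318d` (two (1.8)_{2,0}: φ′-line
through both differentiated legs + both A′-lines), `g318e` (FIFTH picture, see below), `g318f` ((1.8)_{3,0} with an A′-tadpole,
A′-line and φ′-line through both differentiated legs to (1.8)_{1,0}), `g318g` (two (1.6) joined by three φ′-lines) — each with
two external φ′-legs only (`g318_legs`) and, for a, b, c, d, f, g, **D = 6 − 2d in every dimension** (= 0 in d = 3, the printed
*"degrees equal to 0"*; `g318a_deg` … `g318g_deg`).  THE FIFTH PICTURE AS PRINTED shows a vertex with three A′-legs (an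
A′-tadpole and the A′-line) and NO arrowhead, joined by the φ′-line to (1.8)_{1,0} whose arrowhead is drawn: a vertex with three
A′-legs and no differentiation is not in the catalogue ((1.10): *"n + n′ even"*, p. 413); its only catalogue reading — (1.8)_{3,0}
with the differentiated φ′-leg external — is `g318e`, which has one external differentiation and D = 7 − 2d = 1 in d = 3, i.e.
is NOT divergent (`g318e_deg`); with the arrowhead restored at that vertex the picture coincides with the sixth.  READING NOTE
HOME/GAPS.md G-B3-06 (a missing arrowhead in print, not a failed step).  NOT here: one-particle irreducibility and primitivity
(«every proper subgraph convergent») are not modelled; no claim that these seven exhaust the class.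
-/

namespace Literature.MathematicalPhysics.QuantumFieldTheory.Balaban1983to89.B3Sect3Graphs318

open Finset B3Prop1 B3Sect2Statements B3VertexBridge B3Cor23Concrete B3DivergentGraphs

/-! ## The seven pictures (3.18), p. 438 -/

/-- (3.18) first picture: two vertices (1.10)_{2,0} joined by one φ′-line and by both A′-lines; one φ′-leg of each vertex external.
[cite: Balaban1983Higgs3, (3.18) p.438] -/
def g318a (nbar : ℕ) (hn : 2 ≤ nbar) : Graph nbar where
  nV := 2
  kind _ := .v110 2 0
  adm _ := by simp [VertexKind.Admissible, hn]
  other x := match x with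
    | ⟨i, .inl j⟩ => if j.val = 0 then some ⟨i.rev, .inl ⟨0, by simp [VertexKind.scalarLegs]⟩⟩ else none
    | ⟨i, .inr j⟩ => some ⟨i.rev, .inr j⟩
  other_ne := by decide
  other_symm := by decide
  other_isLeft := by decide
  exists_line := by decide

/-- (3.18) second picture: one vertex (1.10)_{4,0} carrying two A′-tadpoles (A′-legs 0–3 and 1–2 joined); both φ′-legs external
(n̄ ≥ 4).
[cite: Balaban1983Higgs3, (3.18) p.438] -/
def g318b (nbar : ℕ) (hn : 4 ≤ nbar) : Graph nbar where
  nV := 1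
  kind _ := .v110 4 0
  adm _ := by simp [VertexKind.Admissible, hn]; decide
  other x := match x with
    | ⟨_, .inl _⟩ => none
    | ⟨i, .inr j⟩ => some ⟨i, .inr j.rev⟩
  other_ne := by decide
  other_symm := by decide
  other_isLeft := by decide
  exists_line := by decide

/-- The vertices of the third picture: (1.8)_{2,0} and (1.10)_{2,0}. [cite: Balaban1983Higgs3, (3.18) p.438] -/
def kind318c : Fin 2 → VertexKind
  | 0 => .v18 2 0
  | 1 => .v110 2 0

/-- (3.18) third picture: (1.8)_{2,0} and (1.10)_{2,0} joined by the φ′-line through the differentiated leg of the first vertex and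
by both A′-lines; one φ′-leg of each vertex external. [cite: Balaban1983Higgs3, (3.18) p.438] -/
def g318c (nbar : ℕ) (hn : 2 ≤ nbar) : Graph nbar where
  nV := 2
  kind := kind318c
  adm i := by fin_cases i <;> simp [kind318c, VertexKind.Admissible, hn]
  other x := match x with
    | ⟨0, .inl j⟩ => if j.val = 0 then some ⟨1, .inl ⟨0, by simp [kind318c, VertexKind.scalarLegs]⟩⟩ else none
    | ⟨1, .inl j⟩ => if j.val = 0 then some ⟨0, .inl ⟨0, by simp [kind318c, VertexKind.scalarLegs]⟩⟩ else none
    | ⟨0, .inr j⟩ => some ⟨1, .inr ⟨j.val, by simpa [kind318c, VertexKind.vectorLegs] using j.isLt⟩⟩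
    | ⟨1, .inr j⟩ => some ⟨0, .inr ⟨j.val, by simpa [kind318c, VertexKind.vectorLegs] using j.isLt⟩⟩
  other_ne := by decide
  other_symm := by decide
  other_isLeft := by decide
  exists_line := by decide

/-- (3.18) fourth picture: two vertices (1.8)_{2,0} joined by the φ′-line through both differentiated legs and by both A′-lines.
[cite: Balaban1983Higgs3, (3.18) p.438] -/
def g318d (nbar : ℕ) (hn : 2 ≤ nbar) : Graph nbar where
  nV := 2
  kind _ := .v18 2 0
  adm _ := by simp [VertexKind.Admissible, hn]
  other x := match x with
    | ⟨i, .inl j⟩ => if j.val = 0 then some ⟨i.rev, .inl ⟨0, by simp [VertexKind.scalarLegs]⟩⟩ else none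
    | ⟨i, .inr j⟩ => some ⟨i.rev, .inr j⟩
  other_ne := by decide
  other_symm := by decide
  other_isLeft := by decide
  exists_line := by decide

/-- The vertices of the fifth and sixth pictures: (1.8)_{3,0} and (1.8)_{1,0}. [cite: Balaban1983Higgs3, (3.18) p.438] -/
def kind318f : Fin 2 → VertexKind
  | 0 => .v18 3 0
  | 1 => .v18 1 0

/-- (3.18) sixth picture: (1.8)_{3,0} carrying an A′-tadpole, joined to (1.8)_{1,0} by the third A′-leg and by the φ′-line through
both differentiated legs; one φ′-leg of each vertex external (n̄ ≥ 3). [cite: Balaban1983Higgs3, (3.18) p.438] -/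
def g318f (nbar : ℕ) (hn : 3 ≤ nbar) : Graph nbar where
  nV := 2
  kind := kind318f
  adm i := by fin_cases i <;> simp [kind318f, VertexKind.Admissible] <;> omega
  other x := match x with
    | ⟨0, .inl j⟩ => if j.val = 0 then some ⟨1, .inl ⟨0, by simp [kind318f, VertexKind.scalarLegs]⟩⟩ else none
    | ⟨1, .inl j⟩ => if j.val = 0 then some ⟨0, .inl ⟨0, by simp [kind318f, VertexKind.scalarLegs]⟩⟩ else none
    | ⟨0, .inr j⟩ =>
      if j.val = 2 then some ⟨1, .inr ⟨0, by simp [kind318f, VertexKind.vectorLegs]⟩⟩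
      else some ⟨0, .inr ⟨1 - j.val, lt_of_le_of_lt (Nat.sub_le 1 j.val) (by decide)⟩⟩
    | ⟨1, .inr _⟩ => some ⟨0, .inr ⟨2, by simp [kind318f, VertexKind.vectorLegs]⟩⟩
  other_ne := by decide
  other_symm := by decide
  other_isLeft := by decide
  exists_line := by decide

/-- (3.18) FIFTH picture AS PRINTED: the same two vertices and lines as the sixth picture, but only ONE arrowhead is drawn, at the
vertex with one A′-leg: the left vertex carries three A′-legs and no differentiation on the internal φ′-line.  A vertex with three
A′-legs and no differentiation is not in the catalogue ((1.10) requires n + n′ even, p. 413); read as (1.8)_{3,0} with its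
differentiated φ′-leg EXTERNAL (the only catalogue reading), the graph is this one — and it is NOT divergent (`g318e_deg`: D = 7 − 2d
= 1 in d = 3).  READING NOTE HOME/GAPS.md G-B3-06. [cite: Balaban1983Higgs3, (3.18) p.438] -/
def g318e (nbar : ℕ) (hn : 3 ≤ nbar) : Graph nbar where
  nV := 2
  kind := kind318f
  adm i := by fin_cases i <;> simp [kind318f, VertexKind.Admissible] <;> omega
  other x := match x with
    | ⟨0, .inl j⟩ => if j.val = 1 then some ⟨1, .inl ⟨0, by simp [kind318f, VertexKind.scalarLegs]⟩⟩ else none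
    | ⟨1, .inl j⟩ => if j.val = 0 then some ⟨0, .inl ⟨1, by simp [kind318f, VertexKind.scalarLegs]⟩⟩ else none
    | ⟨0, .inr j⟩ =>
      if j.val = 2 then some ⟨1, .inr ⟨0, by simp [kind318f, VertexKind.vectorLegs]⟩⟩
      else some ⟨0, .inr ⟨1 - j.val, lt_of_le_of_lt (Nat.sub_le 1 j.val) (by decide)⟩⟩
    | ⟨1, .inr _⟩ => some ⟨0, .inr ⟨2, by simp [kind318f, VertexKind.vectorLegs]⟩⟩
  other_ne := by decide
  other_symm := by decide
  other_isLeft := by decide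
  exists_line := by decide

/-- (3.18) seventh picture: two vertices (1.6) joined by three φ′-lines; the fourth φ′-leg of each external (the «sunset»).
[cite: Balaban1983Higgs3, (3.18) p.438] -/
def g318g (nbar : ℕ) : Graph nbar where
  nV := 2
  kind _ := .v16
  adm _ := trivial
  other x := match x with
    | ⟨i, .inl j⟩ => if h : j.val < 3 then some ⟨i.rev, .inl ⟨j.val, by simp [VertexKind.scalarLegs]⟩⟩ else none
    | ⟨_, .inr j⟩ => j.elim0
  other_ne := by decide
  other_symm := by decide
  other_isLeft := by decide
  exists_line := by decide

variable {nbar : ℕ}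

/-- kernel: the six catalogue pictures of (3.18) have two external φ′-legs only and no differentiation on an external leg; the
fifth picture as printed has its differentiation external. [cite: Balaban1983Higgs3, (3.18) p.438] -/
theorem g318_legs (hn2 : 2 ≤ nbar) (hn3 : 3 ≤ nbar) (hn4 : 4 ≤ nbar) :
    (numExtScalarLegs (g318a nbar hn2) = 2 ∧ numExtVectorLegs (g318a nbar hn2) = 0 ∧ numTildeLegs (g318a nbar hn2) = 0 ∧
      numExtDiffs (g318a nbar hn2) = 0) ∧
    (numExtScalarLegs (g318b nbar hn4) = 2 ∧ numExtVectorLegs (g318b nbar hn4) = 0 ∧ numTildeLegs (g318b nbar hn4) = 0 ∧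
      numExtDiffs (g318b nbar hn4) = 0) ∧
    (numExtScalarLegs (g318c nbar hn2) = 2 ∧ numExtVectorLegs (g318c nbar hn2) = 0 ∧ numTildeLegs (g318c nbar hn2) = 0 ∧
      numExtDiffs (g318c nbar hn2) = 0) ∧
    (numExtScalarLegs (g318d nbar hn2) = 2 ∧ numExtVectorLegs (g318d nbar hn2) = 0 ∧ numTildeLegs (g318d nbar hn2) = 0 ∧
      numExtDiffs (g318d nbar hn2) = 0) ∧
    (numExtScalarLegs (g318e nbar hn3) = 2 ∧ numExtVectorLegs (g318e nbar hn3) = 0 ∧ numTildeLegs (g318e nbar hn3) = 0 ∧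
      numExtDiffs (g318e nbar hn3) = 1) ∧
    (numExtScalarLegs (g318f nbar hn3) = 2 ∧ numExtVectorLegs (g318f nbar hn3) = 0 ∧ numTildeLegs (g318f nbar hn3) = 0 ∧
      numExtDiffs (g318f nbar hn3) = 0) ∧
    (numExtScalarLegs (g318g nbar) = 2 ∧ numExtVectorLegs (g318g nbar) = 0 ∧ numTildeLegs (g318g nbar) = 0 ∧
      numExtDiffs (g318g nbar) = 0) :=
  ⟨⟨by rfl, by rfl, by rfl, by rfl⟩, ⟨by rfl, by rfl, by rfl, by rfl⟩, ⟨by rfl, by rfl, by rfl, by rfl⟩,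
    ⟨by rfl, by rfl, by rfl, by rfl⟩, ⟨by rfl, by rfl, by rfl, by rfl⟩, ⟨by rfl, by rfl, by rfl, by rfl⟩,
    ⟨by rfl, by rfl, by rfl, by rfl⟩⟩

/-- p. 438: *"degrees equal to 0"* — kernel, first picture: D = 6 − 2d (= 0 in d = 3). [cite: Balaban1983Higgs3, (3.18) p.438] -/
theorem g318a_deg (d : ℕ) (hn : 2 ≤ nbar) : (g318a nbar hn).deg d = 6 - 2 * (d : ℚ) := by
  have a0 : (g318a nbar hn).intScalar (0 : Fin 2) = 1 := by rfl
  have a1 : (g318a nbar hn).intScalar (1 : Fin 2) = 1 := by rfl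
  have b0 : (g318a nbar hn).intVector (0 : Fin 2) = 2 := by rfl
  have b1 : (g318a nbar hn).intVector (1 : Fin 2) = 2 := by rfl
  have c0 : (g318a nbar hn).intDiffs (0 : Fin 2) = 0 := by rfl
  have c1 : (g318a nbar hn).intDiffs (1 : Fin 2) = 0 := by rfl
  rw [Graph.deg_eq]
  change (∑ i : Fin 2, (g318a nbar hn).vertexDeg d i) - (d : ℚ) = _
  rw [Fin.sum_univ_two, Graph.vertexDeg_eq, Graph.vertexDeg_eq, a0, a1, b0, b1, c0, c1]
  simp [g318a, VertexKind.etaCount, VertexKind.isAveragingVertex]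
  ring

/-- second picture: D = 6 − 2d. [cite: Balaban1983Higgs3, (3.18) p.438] -/
theorem g318b_deg (d : ℕ) (hn : 4 ≤ nbar) : (g318b nbar hn).deg d = 6 - 2 * (d : ℚ) := by
  have a0 : (g318b nbar hn).intScalar (0 : Fin 1) = 0 := by rfl
  have b0 : (g318b nbar hn).intVector (0 : Fin 1) = 4 := by rfl
  have c0 : (g318b nbar hn).intDiffs (0 : Fin 1) = 0 := by rfl
  rw [Graph.deg_eq]
  change (∑ i : Fin 1, (g318b nbar hn).vertexDeg d i) - (d : ℚ) = _
  rw [Fin.sum_univ_one, Graph.vertexDeg_eq, a0, b0, c0]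
  simp [g318b, VertexKind.etaCount, VertexKind.isAveragingVertex]
  ring

/-- third picture: D = 6 − 2d. [cite: Balaban1983Higgs3, (3.18) p.438] -/
theorem g318c_deg (d : ℕ) (hn : 2 ≤ nbar) : (g318c nbar hn).deg d = 6 - 2 * (d : ℚ) := by
  have a0 : (g318c nbar hn).intScalar (0 : Fin 2) = 1 := by rfl
  have a1 : (g318c nbar hn).intScalar (1 : Fin 2) = 1 := by rfl
  have b0 : (g318c nbar hn).intVector (0 : Fin 2) = 2 := by rfl
  have b1 : (g318c nbar hn).intVector (1 : Fin 2) = 2 := by rfl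
  have c0 : (g318c nbar hn).intDiffs (0 : Fin 2) = 1 := by rfl
  have c1 : (g318c nbar hn).intDiffs (1 : Fin 2) = 0 := by rfl
  rw [Graph.deg_eq]
  change (∑ i : Fin 2, (g318c nbar hn).vertexDeg d i) - (d : ℚ) = _
  rw [Fin.sum_univ_two, Graph.vertexDeg_eq, Graph.vertexDeg_eq, a0, a1, b0, b1, c0, c1]
  simp [g318c, kind318c, VertexKind.etaCount, VertexKind.isAveragingVertex]
  ring

/-- fourth picture: D = 6 − 2d. [cite: Balaban1983Higgs3, (3.18) p.438] -/
theorem g318d_deg (d : ℕ) (hn : 2 ≤ nbar) : (g318d nbar hn).deg d = 6 - 2 * (d : ℚ) := by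
  have a0 : (g318d nbar hn).intScalar (0 : Fin 2) = 1 := by rfl
  have a1 : (g318d nbar hn).intScalar (1 : Fin 2) = 1 := by rfl
  have b0 : (g318d nbar hn).intVector (0 : Fin 2) = 2 := by rfl
  have b1 : (g318d nbar hn).intVector (1 : Fin 2) = 2 := by rfl
  have c0 : (g318d nbar hn).intDiffs (0 : Fin 2) = 1 := by rfl
  have c1 : (g318d nbar hn).intDiffs (1 : Fin 2) = 1 := by rfl
  rw [Graph.deg_eq]
  change (∑ i : Fin 2, (g318d nbar hn).vertexDeg d i) - (d : ℚ) = _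
  rw [Fin.sum_univ_two, Graph.vertexDeg_eq, Graph.vertexDeg_eq, a0, a1, b0, b1, c0, c1]
  simp [g318d, VertexKind.etaCount, VertexKind.isAveragingVertex]
  ring

/-- FIFTH picture as printed (the only catalogue reading): D = 7 − 2d, i.e. D = 1 > 0 in d = 3 — NOT a divergent graph
(HOME/GAPS.md G-B3-06). [cite: Balaban1983Higgs3, (3.18) p.438] -/
theorem g318e_deg (d : ℕ) (hn : 3 ≤ nbar) : (g318e nbar hn).deg d = 7 - 2 * (d : ℚ) := by
  have a0 : (g318e nbar hn).intScalar (0 : Fin 2) = 1 := by rfl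
  have a1 : (g318e nbar hn).intScalar (1 : Fin 2) = 1 := by rfl
  have b0 : (g318e nbar hn).intVector (0 : Fin 2) = 3 := by rfl
  have b1 : (g318e nbar hn).intVector (1 : Fin 2) = 1 := by rfl
  have c0 : (g318e nbar hn).intDiffs (0 : Fin 2) = 0 := by rfl
  have c1 : (g318e nbar hn).intDiffs (1 : Fin 2) = 1 := by rfl
  rw [Graph.deg_eq]
  change (∑ i : Fin 2, (g318e nbar hn).vertexDeg d i) - (d : ℚ) = _
  rw [Fin.sum_univ_two, Graph.vertexDeg_eq, Graph.vertexDeg_eq, a0, a1, b0, b1, c0, c1]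
  simp [g318e, kind318f, VertexKind.etaCount, VertexKind.isAveragingVertex]
  ring

/-- sixth picture: D = 6 − 2d. [cite: Balaban1983Higgs3, (3.18) p.438] -/
theorem g318f_deg (d : ℕ) (hn : 3 ≤ nbar) : (g318f nbar hn).deg d = 6 - 2 * (d : ℚ) := by
  have a0 : (g318f nbar hn).intScalar (0 : Fin 2) = 1 := by rfl
  have a1 : (g318f nbar hn).intScalar (1 : Fin 2) = 1 := by rfl
  have b0 : (g318f nbar hn).intVector (0 : Fin 2) = 3 := by rfl
  have b1 : (g318f nbar hn).intVector (1 : Fin 2) = 1 := by rfl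
  have c0 : (g318f nbar hn).intDiffs (0 : Fin 2) = 1 := by rfl
  have c1 : (g318f nbar hn).intDiffs (1 : Fin 2) = 1 := by rfl
  rw [Graph.deg_eq]
  change (∑ i : Fin 2, (g318f nbar hn).vertexDeg d i) - (d : ℚ) = _
  rw [Fin.sum_univ_two, Graph.vertexDeg_eq, Graph.vertexDeg_eq, a0, a1, b0, b1, c0, c1]
  simp [g318f, kind318f, VertexKind.etaCount, VertexKind.isAveragingVertex]
  ring

/-- seventh picture: D = 6 − 2d. [cite: Balaban1983Higgs3, (3.18) p.438] -/
theorem g318g_deg (d : ℕ) : (g318g nbar).deg d = 6 - 2 * (d : ℚ) := by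
  have a0 : (g318g nbar).intScalar (0 : Fin 2) = 3 := by rfl
  have a1 : (g318g nbar).intScalar (1 : Fin 2) = 3 := by rfl
  have b0 : (g318g nbar).intVector (0 : Fin 2) = 0 := by rfl
  have b1 : (g318g nbar).intVector (1 : Fin 2) = 0 := by rfl
  have c0 : (g318g nbar).intDiffs (0 : Fin 2) = 0 := by rfl
  have c1 : (g318g nbar).intDiffs (1 : Fin 2) = 0 := by rfl
  rw [Graph.deg_eq]
  change (∑ i : Fin 2, (g318g nbar).vertexDeg d i) - (d : ℚ) = _
  rw [Fin.sum_univ_two, Graph.vertexDeg_eq, Graph.vertexDeg_eq, a0, a1, b0, b1, c0, c1]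
  simp [g318g, VertexKind.etaCount, VertexKind.isAveragingVertex]
  ring

end Literature.MathematicalPhysics.QuantumFieldTheory.Balaban1983to89.B3Sect3Graphs318
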